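import Mathlib.Analysis.InnerProductSpace.Projection.Reflection
import HarnessLib

/-!
# Isometric transport between hyperplanes of a real inner product space (Householder-type)

Topic `Analysis/InnerProduct`.  Let `E` be a real inner product space and `a, b ∈ E` two vectors
of the same length (typically unit normals of two hyperplanes `aᗮ`, `bᗮ`).  The **transport**
from `aᗮ` to `bᗮ` used here is Mathlib's reflection in the bisector line,

  `R_{a,b} := (ℝ ∙ (a + b)).reflection : E ≃ₗᵢ[ℝ] E`,   `R_{a,b} x = 2 P_{ℝ(a+b)} x - x`,

which is *minus* the Householder reflection in the bisecting hyperplane `(a + b)ᗮ`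
(`Submodule.reflection_orthogonal_apply`; Householder's textbook choice reflects in `(a - b)ᗮ`
instead, which is discontinuous at `b = a` — ours is the identity on `ℝ a` composed with `-1` on
`aᗮ` at `b = a`, and depends Lipschitz-continuously on `b` as long as `a + b` stays away from `0`).
We prove:

* `reflection_span_add_apply_left_of_norm_eq` / `…_right_…`, `reflection_span_add_comm` —
  `R_{a,b} a = b`, `R_{a,b} b = a`, `R_{a,b} = R_{b,a}` whenever `‖a‖ = ‖b‖` (no non-degeneracy
  needed: for `b = -a` the line is `⊥` and the map is `-id`);
* `inner_reflection_span_add_of_norm_eq` — `⟪b, R_{a,b} x⟫ = ⟪a, x⟫`; hence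
  `reflection_span_add_mem_orthogonal_iff`, `map_orthogonal_reflection_span_add`,
  `image_reflection_span_add_setOf_inner_eq_zero`, `image_affine_reflection_span_add`: `R_{a,b}`
  maps the hyperplane `aᗮ` ONTO `bᗮ` (and `x ↦ q + R_{a,b} (x - p)` maps the affine section
  `p + aᗮ` onto `q + bᗮ`); it is a linear isometric involution of `E`
  (`Submodule.reflection_reflection`);
* `norm_reflection_span_singleton_sub_le` — Lipschitz dependence on the line:
  `‖(ℝ ∙ d).reflection x - (ℝ ∙ d').reflection x‖ ≤ 8 (‖d - d'‖ / ‖d‖) ‖x‖` for `d ≠ 0` and all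
  `d'`, the operator-norm form `opNorm_reflection_span_singleton_sub_le`, the specialisations
  `norm_reflection_span_add_sub_le` / `opNorm_reflection_span_add_sub_le`:
  `‖R_{a,b} - R_{a,b'}‖ ≤ 8 ‖b - b'‖` once `1 ≤ ‖a + b‖` (which holds for unit `a, b` with
  `‖a - b‖ ≤ 1`, `two_mul_norm_sub_norm_sub_le_norm_add`), and continuity of
  `d ↦ (ℝ ∙ d).reflection` in operator norm off `d = 0`
  (`continuousAt_reflection_span_singleton`, `continuousOn_reflection_span_add`).

Use (infrastructure for Poincaré sections of semiflows on Hilbert spaces, Katok 1980 §3 for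
diffeomorphisms, Lian–Young 2012 for semiflows): along an orbit the sections `x_k + X̂_kᗮ`
(`X̂_k` the unit flow direction) are all identified isometrically with one model hyperplane `e₀ᗮ`
by `R_{e₀, X̂_k}` (any unit `e₀`, e.g. `e₀ = X̂_0`, for which `‖e₀ + X̂_0‖ = 2 ≥ 1`), and at a
near-return `X̂_n ≈ X̂_0` the identifications differ by `≤ 8 ‖X̂_n - X̂_0‖` in operator norm.

All statements are elementary linear algebra; nothing here is specific to finite dimension or to
completeness of `E` (the line `ℝ ∙ d` is complete, which is all `Submodule.reflection` needs).

## References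

* A. S. Householder, *Unitary triangularization of a nonsymmetric matrix*, J. ACM 5 (1958),
  339–342 (the reflections `1 - 2 v vᵀ`).
* A. Katok, *Lyapunov exponents, entropy and periodic orbits for diffeomorphisms*, Publ. Math.
  IHÉS 51 (1980), 137–173, §3 [Katok1980].
* Z. Lian, L.-S. Young, *Lyapunov exponents, periodic orbits, and horseshoes for semiflows on
  Hilbert spaces*, J. Amer. Math. Soc. 25 (2012), 637–665 (Poincaré sections of semiflows)
  [LianYoung2012].
-/

noncomputable section

open Submodule Filter
open scoped InnerProductSpace RealInnerProductSpace _root_.Topology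

namespace Literature.Analysis.InnerProduct

variable {E : Type*} [NormedAddCommGroup E] [InnerProductSpace ℝ E]

/-! ### The reflection in the bisector line swaps `a` and `b` -/

/-- **The reflection in the line `ℝ (a + b)` maps `a` to `b`** whenever `‖a‖ = ‖b‖`.  It is minus
the reflection in the bisecting hyperplane `(a + b)ᗮ = (a - (-b))ᗮ`, which maps `a` to `-b`
(`Submodule.reflection_sub`).  No non-degeneracy is needed: for `b = -a` the line is `⊥` and the
reflection is `-id`. [folklore] -/
theorem reflection_span_add_apply_left_of_norm_eq {a b : E} (h : ‖a‖ = ‖b‖) :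
    (ℝ ∙ (a + b)).reflection a = b := by
  have h1 : (ℝ ∙ (a + b))ᗮ.reflection a = -b := by
    rw [← sub_neg_eq_add]
    exact reflection_sub (by rw [norm_neg, h])
  have h2 := reflection_orthogonal_apply (ℝ ∙ (a + b)) a
  exact neg_inj.1 (h2.symm.trans h1)

/-- The reflection in the line `ℝ (a + b)` maps `b` to `a` whenever `‖a‖ = ‖b‖`. [folklore] -/
theorem reflection_span_add_apply_right_of_norm_eq {a b : E} (h : ‖a‖ = ‖b‖) :
    (ℝ ∙ (a + b)).reflection b = a := by
  rw [add_comm]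
  exact reflection_span_add_apply_left_of_norm_eq h.symm

/-- The transport is symmetric in `(a, b)`: the reflections in `ℝ (a + b)` and `ℝ (b + a)` are
the same map (so, being an involution, `Submodule.reflection_reflection`, the transport from `bᗮ`
back to `aᗮ` is the same isometry). [folklore] -/
theorem reflection_span_add_comm (a b : E) :
    (ℝ ∙ (a + b)).reflection = (ℝ ∙ (b + a)).reflection := by
  rw [add_comm]

/-- **The transport preserves the normal component**: `⟪b, R x⟫ = ⟪a, x⟫` for the reflection `R`
in the line `ℝ (a + b)`, `‖a‖ = ‖b‖` (an isometry with `R a = b`). [folklore] -/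
theorem inner_reflection_span_add_of_norm_eq {a b : E} (h : ‖a‖ = ‖b‖) (x : E) :
    ⟪b, (ℝ ∙ (a + b)).reflection x⟫_ℝ = ⟪a, x⟫_ℝ := by
  have := (ℝ ∙ (a + b)).reflection.inner_map_map a x
  rwa [reflection_span_add_apply_left_of_norm_eq h] at this

/-- Symmetric form: `⟪a, R x⟫ = ⟪b, x⟫` for the reflection `R` in `ℝ (a + b)`, `‖a‖ = ‖b‖`.
[folklore] -/
theorem inner_reflection_span_add_of_norm_eq' {a b : E} (h : ‖a‖ = ‖b‖) (x : E) :
    ⟪a, (ℝ ∙ (a + b)).reflection x⟫_ℝ = ⟪b, x⟫_ℝ := by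
  rw [add_comm]
  exact inner_reflection_span_add_of_norm_eq h.symm x

/-- The reflection in `ℝ (a + b)` maps `x` into the hyperplane `bᗮ` iff `x` lies in the hyperplane
`aᗮ` (`‖a‖ = ‖b‖`). [folklore] -/
theorem reflection_span_add_mem_orthogonal_iff {a b : E} (h : ‖a‖ = ‖b‖) {x : E} :
    (ℝ ∙ (a + b)).reflection x ∈ (ℝ ∙ b)ᗮ ↔ x ∈ (ℝ ∙ a)ᗮ := by
  rw [mem_orthogonal_singleton_iff_inner_right, mem_orthogonal_singleton_iff_inner_right,
    inner_reflection_span_add_of_norm_eq h]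

/-- **The transport maps the hyperplane `aᗮ` onto `bᗮ`** (submodule form): the image of `(ℝ ∙ a)ᗮ`
under the reflection in `ℝ (a + b)` is `(ℝ ∙ b)ᗮ`, for `‖a‖ = ‖b‖`. [folklore] -/
theorem map_orthogonal_reflection_span_add {a b : E} (h : ‖a‖ = ‖b‖) :
    (ℝ ∙ a)ᗮ.map ((ℝ ∙ (a + b)).reflection.toLinearEquiv : E →ₗ[ℝ] E) = (ℝ ∙ b)ᗮ := by
  ext y
  rw [mem_map_equiv]
  change (ℝ ∙ (a + b)).reflection y ∈ (ℝ ∙ a)ᗮ ↔ y ∈ (ℝ ∙ b)ᗮ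
  rw [← reflection_span_add_mem_orthogonal_iff h, reflection_reflection]

/-- **The transport maps the hyperplane `aᗮ` onto `bᗮ`** (set form): the reflection in `ℝ (a + b)`
maps `{x | ⟪a, x⟫ = 0}` onto `{y | ⟪b, y⟫ = 0}`, for `‖a‖ = ‖b‖`. [folklore] -/
theorem image_reflection_span_add_setOf_inner_eq_zero {a b : E} (h : ‖a‖ = ‖b‖) :
    (ℝ ∙ (a + b)).reflection '' {x | ⟪a, x⟫_ℝ = 0} = {y | ⟪b, y⟫_ℝ = 0} := by
  ext y
  simp only [Set.mem_image, Set.mem_setOf_eq]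
  constructor
  · rintro ⟨x, hx, rfl⟩
    rwa [inner_reflection_span_add_of_norm_eq h]
  · intro hy
    refine ⟨(ℝ ∙ (a + b)).reflection y, ?_, reflection_reflection _ _⟩
    rwa [← inner_reflection_span_add_of_norm_eq h, reflection_reflection]

/-- The transport between the affine sections: `x ↦ q + R (x - p)` (`R` the reflection in
`ℝ (a + b)`, `‖a‖ = ‖b‖`) maps the affine hyperplane `{x | ⟪a, x - p⟫ = 0}` through `p` onto the
affine hyperplane `{y | ⟪b, y - q⟫ = 0}` through `q`, isometrically. [folklore] -/
theorem image_affine_reflection_span_add {a b : E} (h : ‖a‖ = ‖b‖) (p q : E) :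
    (fun x => q + (ℝ ∙ (a + b)).reflection (x - p)) '' {x | ⟪a, x - p⟫_ℝ = 0} =
      {y | ⟪b, y - q⟫_ℝ = 0} := by
  ext y
  simp only [Set.mem_image, Set.mem_setOf_eq]
  constructor
  · rintro ⟨x, hx, rfl⟩
    rwa [add_sub_cancel_left, inner_reflection_span_add_of_norm_eq h]
  · intro hy
    refine ⟨p + (ℝ ∙ (a + b)).reflection (y - q), ?_, ?_⟩
    · rwa [add_sub_cancel_left, ← inner_reflection_span_add_of_norm_eq h, reflection_reflection]
    · rw [add_sub_cancel_left, reflection_reflection, add_sub_cancel]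

/-! ### Lipschitz dependence of the line reflection on the line -/

/-- The orthogonal projection onto the line `ℝ d` in normalised form:
`P x = ⟪u, x⟫ u` with `u = d / ‖d‖` (both sides vanish for `d = 0`). [folklore] -/
theorem starProjection_span_singleton_eq_inner_normalize_smul (d x : E) :
    (ℝ ∙ d).starProjection x = ⟪‖d‖⁻¹ • d, x⟫_ℝ • ‖d‖⁻¹ • d := by
  rw [starProjection_singleton ℝ x, real_inner_smul_left, smul_smul]
  simp only [RCLike.ofReal_real_eq_id, id_eq]
  congr 1
  ring

/-- Rank-one operators `x ↦ ⟪u, x⟫ u` depend Lipschitz-continuously on `u`: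
`‖⟪u, x⟫ u - ⟪u', x⟫ u'‖ ≤ (‖u‖ + ‖u'‖) ‖u - u'‖ ‖x‖`. [folklore] -/
theorem norm_inner_smul_self_sub_inner_smul_self_le (u u' x : E) :
    ‖⟪u, x⟫_ℝ • u - ⟪u', x⟫_ℝ • u'‖ ≤ (‖u‖ + ‖u'‖) * ‖u - u'‖ * ‖x‖ := by
  have e : ⟪u, x⟫_ℝ • u - ⟪u', x⟫_ℝ • u' = ⟪u - u', x⟫_ℝ • u + ⟪u', x⟫_ℝ • (u - u') := by
    rw [inner_sub_left, sub_smul, smul_sub]; abel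
  rw [e]
  calc ‖⟪u - u', x⟫_ℝ • u + ⟪u', x⟫_ℝ • (u - u')‖
      ≤ ‖⟪u - u', x⟫_ℝ • u‖ + ‖⟪u', x⟫_ℝ • (u - u')‖ := norm_add_le _ _
    _ = |⟪u - u', x⟫_ℝ| * ‖u‖ + |⟪u', x⟫_ℝ| * ‖u - u'‖ := by
        rw [norm_smul, norm_smul, Real.norm_eq_abs, Real.norm_eq_abs]
    _ ≤ ‖u - u'‖ * ‖x‖ * ‖u‖ + ‖u'‖ * ‖x‖ * ‖u - u'‖ := by
        gcongr <;> exact abs_real_inner_le_norm _ _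
    _ = (‖u‖ + ‖u'‖) * ‖u - u'‖ * ‖x‖ := by ring

-- adapted from Literature/Topology/FourManifolds/ConeDifferentialLink.lean
-- (`norm_inv_norm_smul_sub_inv_norm_smul_le`, there with the other denominator and `d' ≠ 0`)
/-- Normalisation is Lipschitz off the origin: `‖d/‖d‖ - d'/‖d'‖‖ ≤ 2 ‖d - d'‖ / ‖d‖` for `d ≠ 0`
(and any `d'`; for `d' = 0` the left side is `1 ≤ 2`). [folklore] -/
theorem norm_normalize_sub_normalize_le_div_left {d : E} (hd : d ≠ 0) (d' : E) :
    ‖‖d‖⁻¹ • d - ‖d'‖⁻¹ • d'‖ ≤ 2 * ‖d - d'‖ / ‖d‖ := by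
  have hd0 : 0 < ‖d‖ := norm_pos_iff.2 hd
  rcases eq_or_ne d' 0 with rfl | hd'
  · have h1 : ‖‖d‖⁻¹ • d‖ ≤ 1 := (norm_smul_inv_norm hd).le
    rw [norm_zero, inv_zero, zero_smul, sub_zero, sub_zero, mul_div_assoc, div_self hd0.ne']
    linarith
  have hd0' : 0 < ‖d'‖ := norm_pos_iff.2 hd'
  calc ‖‖d‖⁻¹ • d - ‖d'‖⁻¹ • d'‖
      ≤ ‖‖d‖⁻¹ • d - ‖d‖⁻¹ • d'‖ + ‖‖d‖⁻¹ • d' - ‖d'‖⁻¹ • d'‖ :=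
        norm_sub_le_norm_sub_add_norm_sub _ _ _
    _ = ‖d‖⁻¹ * ‖d - d'‖ + |‖d‖⁻¹ - ‖d'‖⁻¹| * ‖d'‖ := by
        rw [← smul_sub, norm_smul, ← sub_smul, norm_smul, Real.norm_eq_abs, Real.norm_eq_abs,
          abs_of_pos (inv_pos.2 hd0)]
    _ = ‖d - d'‖ / ‖d‖ + |‖d'‖ - ‖d‖| / ‖d‖ := by
        rw [inv_sub_inv hd0.ne' hd0'.ne', abs_div, abs_of_pos (mul_pos hd0 hd0')]
        field_simp
    _ ≤ ‖d - d'‖ / ‖d‖ + ‖d - d'‖ / ‖d‖ := by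
        gcongr
        rw [abs_sub_comm]
        exact abs_norm_sub_norm_le d d'
    _ = 2 * ‖d - d'‖ / ‖d‖ := by ring

/-- **Lipschitz dependence of the line reflection on the line.**  For `d ≠ 0` and all `d'`, `x`,
`‖(ℝ ∙ d).reflection x - (ℝ ∙ d').reflection x‖ ≤ 8 (‖d - d'‖ / ‖d‖) ‖x‖`
(from `R = 2P - 1`, `P x = ⟪u, x⟫ u` with `u = d/‖d‖`, and the two preceding estimates; for
`d' = 0` the second reflection is `-id`). [folklore] -/
theorem norm_reflection_span_singleton_sub_le {d : E} (hd : d ≠ 0) (d' x : E) :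
    ‖(ℝ ∙ d).reflection x - (ℝ ∙ d').reflection x‖ ≤ 8 * (‖d - d'‖ / ‖d‖) * ‖x‖ := by
  set u : E := ‖d‖⁻¹ • d with hu
  set u' : E := ‖d'‖⁻¹ • d' with hu'
  have hu1 : ‖u‖ ≤ 1 := (norm_smul_inv_norm hd).le
  have hu1' : ‖u'‖ ≤ 1 := by
    rcases eq_or_ne d' 0 with h0 | h0
    · simp [hu', h0]
    · exact (norm_smul_inv_norm h0).le
  have hsub : (ℝ ∙ d).reflection x - (ℝ ∙ d').reflection x =
      (2 : ℝ) • (⟪u, x⟫_ℝ • u - ⟪u', x⟫_ℝ • u') := by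
    simp only [reflection_apply, starProjection_span_singleton_eq_inner_normalize_smul, two_smul,
      smul_sub]
    abel
  rw [hsub, norm_smul, Real.norm_ofNat]
  have h1 := norm_inner_smul_self_sub_inner_smul_self_le u u' x
  have h2 : ‖u - u'‖ ≤ 2 * ‖d - d'‖ / ‖d‖ := norm_normalize_sub_normalize_le_div_left hd d'
  calc 2 * ‖⟪u, x⟫_ℝ • u - ⟪u', x⟫_ℝ • u'‖ ≤ 2 * ((‖u‖ + ‖u'‖) * ‖u - u'‖ * ‖x‖) := by gcongr
    _ ≤ 2 * ((1 + 1) * (2 * ‖d - d'‖ / ‖d‖) * ‖x‖) := by gcongr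
    _ = 8 * (‖d - d'‖ / ‖d‖) * ‖x‖ := by ring

/-- Operator-norm form of `norm_reflection_span_singleton_sub_le`:
`‖(ℝ ∙ d).reflection - (ℝ ∙ d').reflection‖ ≤ 8 ‖d - d'‖ / ‖d‖` for `d ≠ 0`. [folklore] -/
theorem opNorm_reflection_span_singleton_sub_le {d : E} (hd : d ≠ 0) (d' : E) :
    ‖((ℝ ∙ d).reflection : E →L[ℝ] E) - ((ℝ ∙ d').reflection : E →L[ℝ] E)‖ ≤
      8 * (‖d - d'‖ / ‖d‖) :=
  ContinuousLinearMap.opNorm_le_bound _ (by positivity) fun x => by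
    simpa using norm_reflection_span_singleton_sub_le hd d' x

/-- For a unit vector `a` (or any `a`): `2 ‖a‖ - ‖a - b‖ ≤ ‖a + b‖`; in particular
`1 ≤ ‖a + b‖` for unit vectors at distance `≤ 1`. [folklore] -/
theorem two_mul_norm_sub_norm_sub_le_norm_add (a b : E) : 2 * ‖a‖ - ‖a - b‖ ≤ ‖a + b‖ := by
  have h : (2 : ℝ) • a = (a + b) + (a - b) := by rw [two_smul]; abel
  have := norm_add_le (a + b) (a - b)
  rw [← h, norm_smul, Real.norm_ofNat] at this
  linarith

/-- **Lipschitz dependence of the transport on the target normal.**  If `1 ≤ ‖a + b‖` (e.g.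
`a, b` unit vectors with `‖a - b‖ ≤ 1`, `two_mul_norm_sub_norm_sub_le_norm_add`), then
`‖R_{a,b} x - R_{a,b'} x‖ ≤ 8 ‖b - b'‖ ‖x‖` for the reflections in the lines `ℝ (a + b)`,
`ℝ (a + b')` and every `b'`. [folklore] -/
theorem norm_reflection_span_add_sub_le {a b : E} (hab : 1 ≤ ‖a + b‖) (b' x : E) :
    ‖(ℝ ∙ (a + b)).reflection x - (ℝ ∙ (a + b')).reflection x‖ ≤ 8 * ‖b - b'‖ * ‖x‖ := by
  have hab0 : a + b ≠ 0 := by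
    rintro h; rw [h, norm_zero] at hab; exact absurd hab (by norm_num)
  refine (norm_reflection_span_singleton_sub_le hab0 (a + b') x).trans ?_
  rw [add_sub_add_left_eq_sub]
  gcongr
  exact div_le_self (norm_nonneg _) hab

/-- Operator-norm form of `norm_reflection_span_add_sub_le`:
`‖R_{a,b} - R_{a,b'}‖ ≤ 8 ‖b - b'‖` once `1 ≤ ‖a + b‖`. [folklore] -/
theorem opNorm_reflection_span_add_sub_le {a b : E} (hab : 1 ≤ ‖a + b‖) (b' : E) :
    ‖((ℝ ∙ (a + b)).reflection : E →L[ℝ] E) - ((ℝ ∙ (a + b')).reflection : E →L[ℝ] E)‖ ≤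
      8 * ‖b - b'‖ :=
  ContinuousLinearMap.opNorm_le_bound _ (by positivity) fun x => by
    simpa using norm_reflection_span_add_sub_le hab b' x

/-! ### Continuity in operator norm -/

/-- The line reflection `d ↦ (ℝ ∙ d).reflection`, as a map into bounded operators, is continuous
(in operator norm) at every `d ≠ 0`. [folklore] -/
theorem continuousAt_reflection_span_singleton {d₀ : E} (hd₀ : d₀ ≠ 0) :
    ContinuousAt (fun d : E => ((ℝ ∙ d).reflection : E →L[ℝ] E)) d₀ := by
  rw [ContinuousAt, tendsto_iff_norm_sub_tendsto_zero]
  have hlim : Tendsto (fun d : E => 8 * (‖d₀ - d‖ / ‖d₀‖)) (𝓝 d₀) (𝓝 0) := by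
    have : Tendsto (fun d : E => 8 * (‖d₀ - d‖ / ‖d₀‖)) (𝓝 d₀)
        (𝓝 (8 * (‖d₀ - d₀‖ / ‖d₀‖))) :=
      ((tendsto_const_nhds.sub tendsto_id).norm.div_const _).const_mul _
    simpa using this
  refine squeeze_zero (fun _ => norm_nonneg _) (fun d => ?_) hlim
  rw [norm_sub_rev]
  exact opNorm_reflection_span_singleton_sub_le hd₀ d

/-- The line reflection is continuous in operator norm on `{d | d ≠ 0}`. [folklore] -/
theorem continuousOn_reflection_span_singleton :
    ContinuousOn (fun d : E => ((ℝ ∙ d).reflection : E →L[ℝ] E)) {d | d ≠ 0} := fun _ hd =>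
  (continuousAt_reflection_span_singleton hd).continuousWithinAt

/-- The transport `b ↦ (ℝ ∙ (a + b)).reflection` is continuous in operator norm on
`{b | a + b ≠ 0}` (in particular near `b = a ≠ 0`). [folklore] -/
theorem continuousOn_reflection_span_add (a : E) :
    ContinuousOn (fun b : E => ((ℝ ∙ (a + b)).reflection : E →L[ℝ] E)) {b | a + b ≠ 0} :=
  continuousOn_reflection_span_singleton.comp (continuous_const.add continuous_id).continuousOn
    fun _ hb => hb

end Literature.Analysis.InnerProduct
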